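import Summits.Ventures.HodgeRepro2.T5SU11ReductionOfOrderOrigin
import Summits.Ventures.HodgeRepro2.T5SU11SphericalSolutionSpaceAll

/-!
# `φ_λ(a_t)` is THE regular solution: the second spherical solution blows up at `t = 0`, a solution bounded at `0⁺` is a multiple of `φ_λ`

Rows 444–445 give, at every real `λ`, the basis `φ_λ(a_·), ψ_λ` of the solution space of the radial equation on
`(0, ∞)` and the behaviour of the second solution of a positive `φ` at the origin. Here `φ = φ_λ ∘ a` is continuous
and positive on the compact `[0, 1]`, so it is bounded there by `0 < m ≤ φ ≤ M` (`exists_bounds_sph_hyp`), and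
row 445 applies:

* **`ψ_λ(t) → −∞` as `t → 0⁺`** (`tendsto_sphSecond_nhdsGT_zero`) — the second spherical solution has the
  logarithmic singularity of the regular-singular point `t = 0`;
* **the regular solution is unique**: a solution `u` on `(0, ∞)` bounded as `t → 0⁺` is
  `(u(1)/φ_λ(a_1)) · φ_λ(a_·)` (`eq_const_mul_sph_of_bounded`, `exists_eq_const_mul_sph_of_bounded`, also in
  the classical `deriv` form `exists_eq_const_mul_sph_of_bounded_deriv`), and **a solution with limit `1` at
  `0⁺` IS `φ_λ(a_·)`** (`eq_sph_hyp_of_ode_of_tendsto`) — the characterisation of the spherical function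
  among the solutions on `(0, ∞)` by its boundary behaviour alone (row 338's `eq_sph_hyp_of_ode` needed a
  `C²` solution on all of `ℝ`);
* at `λ = 2n + 2`: **`Q_n(cosh 2t) → +∞` as `t → 0⁺`** (`tendsto_sphQ_nhdsGT_zero`, from row 444's
  `Q_n(cosh 2t) = c φ_{2n+2}(a_t) − 2 ψ_{2n+2}(t)`).

Nothing is claimed about (N).

Blind lane: Mathlib + the HodgeRepro2 prefix only; no sorry; axioms ⊆ {propext, Classical.choice,
Quot.sound}.
-/

namespace Summit.Ventures.HodgeRepro2.T5SU11SphericalRegular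

open Filter Topology
open Set (Ioi Icc)
open T5SU11OneParameter T5SU11Cartan T5SU11SphericalFunction T5SU11SphericalBounds T5SU11SphericalDeriv
  T5SU11SphericalODE T5SU11ReductionOfOrder T5SU11ReductionOfOrderOrigin T5SU11SphericalSolutionSpaceAll
  T5SU11SphericalSecondKind

section measure

variable [MeasurableSpace Circle] [BorelSpace Circle]

/-! ### Bounds of `φ_λ ∘ a` on `(0, 1]` -/

/-- `φ_λ ∘ a` is bounded away from `0` and from above on `(0, 1]` (continuity on the compact `[0, 1]`). -/
theorem exists_bounds_sph_hyp (lam : ℝ) : ∃ m M : ℝ, 0 < m ∧ (∀ s, 0 < s → s ≤ 1 → m ≤ sph lam (hyp s)) ∧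
    ∀ s, 0 < s → s ≤ 1 → sph lam (hyp s) ≤ M := by
  have hc : ContinuousOn (fun t => sph lam (hyp t)) (Icc 0 1) :=
    (differentiable_sph_hyp lam).continuous.continuousOn
  obtain ⟨x, _, hxmin⟩ := isCompact_Icc.exists_isMinOn (Set.nonempty_Icc.mpr zero_le_one) hc
  obtain ⟨y, _, hymax⟩ := isCompact_Icc.exists_isMaxOn (Set.nonempty_Icc.mpr zero_le_one) hc
  exact ⟨sph lam (hyp x), sph lam (hyp y), sph_hyp_pos lam x, fun s hs0 hs1 => hxmin ⟨hs0.le, hs1⟩,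
    fun s hs0 hs1 => hymax ⟨hs0.le, hs1⟩⟩

/-! ### The second spherical solution at the origin -/

/-- **`ψ_λ(t) → −∞` as `t → 0⁺`.** -/
theorem tendsto_sphSecond_nhdsGT_zero (lam : ℝ) : Tendsto (sphSecond lam) (𝓝[>] 0) atBot := by
  obtain ⟨m, M, hm0, hm, hM⟩ := exists_bounds_sph_hyp lam
  exact tendsto_secondSolution_nhdsGT_zero (hφ_sph lam) (hpos_sph lam) hm hM hm0

/-- `ψ_λ` is not bounded below near `0⁺`. -/
theorem not_bddBelow_sphSecond (lam : ℝ) : ¬ ∃ B : ℝ, ∀ t, 0 < t → B ≤ sphSecond lam t := by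
  rintro ⟨B, hB⟩
  have h := (tendsto_sphSecond_nhdsGT_zero lam).eventually (eventually_lt_atBot B)
  obtain ⟨t, ht1, ht2⟩ := (h.and self_mem_nhdsWithin).exists
  exact absurd (hB t ht2) (not_le.mpr ht1)

/-! ### The regular solution is unique -/

/-- **THE REGULAR SOLUTION IS UNIQUE**: a solution `u` of `sinh 2t · u″ + 2 cosh 2t · u′ = λ(λ − 2) sinh 2t · u`
on `(0, ∞)` that stays bounded as `t → 0⁺` is `(u(1)/φ_λ(a_1)) · φ_λ(a_·)`. -/
theorem eq_const_mul_sph_of_bounded (lam : ℝ) {u u' u'' : ℝ → ℝ}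
    (hu : ∀ t, 0 < t → HasDerivAt u (u' t) t) (hu' : ∀ t, 0 < t → HasDerivAt u' (u'' t) t)
    (hode : ∀ t, 0 < t → Real.sinh (2 * t) * u'' t + 2 * Real.cosh (2 * t) * u' t
      = lam * (lam - 2) * Real.sinh (2 * t) * u t)
    {B : ℝ} (hB : ∀ᶠ t in 𝓝[>] (0 : ℝ), |u t| ≤ B) {t : ℝ} (ht : 0 < t) :
    u t = (u 1 / sph lam (hyp 1)) * sph lam (hyp t) := by
  obtain ⟨m, M, hm0, hm, hM⟩ := exists_bounds_sph_hyp lam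
  exact eq_const_mul_of_bounded (hφ_sph lam) (hφ'_sph lam) (hpos_sph lam) hm hM hm0 (hode_sph lam)
    hu hu' hode hB ht

/-- A solution bounded as `t → 0⁺` is a constant multiple of `φ_λ(a_·)` on `(0, ∞)`. -/
theorem exists_eq_const_mul_sph_of_bounded (lam : ℝ) {u u' u'' : ℝ → ℝ}
    (hu : ∀ t, 0 < t → HasDerivAt u (u' t) t) (hu' : ∀ t, 0 < t → HasDerivAt u' (u'' t) t)
    (hode : ∀ t, 0 < t → Real.sinh (2 * t) * u'' t + 2 * Real.cosh (2 * t) * u' t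
      = lam * (lam - 2) * Real.sinh (2 * t) * u t)
    {B : ℝ} (hB : ∀ᶠ t in 𝓝[>] (0 : ℝ), |u t| ≤ B) :
    ∃ c : ℝ, ∀ t, 0 < t → u t = c * sph lam (hyp t) :=
  ⟨u 1 / sph lam (hyp 1), fun _ ht => eq_const_mul_sph_of_bounded lam hu hu' hode hB ht⟩

/-- A solution with a FINITE LIMIT as `t → 0⁺` is `(u(1)/φ_λ(a_1)) · φ_λ(a_·)`. -/
theorem eq_const_mul_sph_of_tendsto (lam : ℝ) {u u' u'' : ℝ → ℝ}
    (hu : ∀ t, 0 < t → HasDerivAt u (u' t) t) (hu' : ∀ t, 0 < t → HasDerivAt u' (u'' t) t)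
    (hode : ∀ t, 0 < t → Real.sinh (2 * t) * u'' t + 2 * Real.cosh (2 * t) * u' t
      = lam * (lam - 2) * Real.sinh (2 * t) * u t)
    {L : ℝ} (hL : Tendsto u (𝓝[>] 0) (𝓝 L)) {t : ℝ} (ht : 0 < t) :
    u t = (u 1 / sph lam (hyp 1)) * sph lam (hyp t) := by
  obtain ⟨m, M, hm0, hm, hM⟩ := exists_bounds_sph_hyp lam
  exact eq_const_mul_of_tendsto (hφ_sph lam) (hφ'_sph lam) (hpos_sph lam) hm hM hm0 (hode_sph lam)
    hu hu' hode hL ht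

/-- `φ_λ(a_t) → 1` as `t → 0⁺` (continuity and `φ_λ(a_0) = φ_λ(1) = 1`). -/
theorem tendsto_sph_hyp_nhdsGT_zero (lam : ℝ) : Tendsto (fun t => sph lam (hyp t)) (𝓝[>] 0) (𝓝 1) := by
  have h : Tendsto (fun t => sph lam (hyp t)) (𝓝[>] 0) (𝓝 (sph lam (hyp 0))) :=
    ((differentiable_sph_hyp lam).continuous.tendsto 0).mono_left nhdsWithin_le_nhds
  rwa [hyp_zero, sph_one] at h

/-- **THE SPHERICAL FUNCTION IS THE SOLUTION WITH LIMIT `1` AT THE ORIGIN**: a solution `u` of the radial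
equation on `(0, ∞)` with `u(t) → 1` as `t → 0⁺` equals `φ_λ(a_t)` on `(0, ∞)`. -/
theorem eq_sph_hyp_of_ode_of_tendsto (lam : ℝ) {u u' u'' : ℝ → ℝ}
    (hu : ∀ t, 0 < t → HasDerivAt u (u' t) t) (hu' : ∀ t, 0 < t → HasDerivAt u' (u'' t) t)
    (hode : ∀ t, 0 < t → Real.sinh (2 * t) * u'' t + 2 * Real.cosh (2 * t) * u' t
      = lam * (lam - 2) * Real.sinh (2 * t) * u t)
    (hL : Tendsto u (𝓝[>] 0) (𝓝 1)) {t : ℝ} (ht : 0 < t) : u t = sph lam (hyp t) := by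
  have hrep : ∀ s, 0 < s → u s = (u 1 / sph lam (hyp 1)) * sph lam (hyp s) :=
    fun s hs => eq_const_mul_sph_of_tendsto lam hu hu' hode hL hs
  -- the constant is `1`: compare the limits at `0⁺`
  have h1 : Tendsto (fun s => (u 1 / sph lam (hyp 1)) * sph lam (hyp s)) (𝓝[>] 0)
      (𝓝 ((u 1 / sph lam (hyp 1)) * 1)) := (tendsto_sph_hyp_nhdsGT_zero lam).const_mul _
  have h2 : Tendsto u (𝓝[>] 0) (𝓝 ((u 1 / sph lam (hyp 1)) * 1)) := by
    refine h1.congr' ?_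
    filter_upwards [self_mem_nhdsWithin] with s hs
    exact (hrep s hs).symm
  have hc : (u 1 / sph lam (hyp 1)) * 1 = 1 := tendsto_nhds_unique h2 hL
  rw [mul_one] at hc
  rw [hrep t ht, hc, one_mul]

/-- **The classical form**: a function twice differentiable on `(0, ∞)` with `u″ + 2 coth 2t · u′ = λ(λ − 2) u`
there and bounded as `t → 0⁺` is a constant multiple of `φ_λ(a_·)`. -/
theorem exists_eq_const_mul_sph_of_bounded_deriv (lam : ℝ) {u : ℝ → ℝ}
    (hu : ∀ t, 0 < t → DifferentiableAt ℝ u t) (hu' : ∀ t, 0 < t → DifferentiableAt ℝ (deriv u) t)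
    (hode : ∀ t, 0 < t → deriv (deriv u) t + 2 * (Real.cosh (2 * t) / Real.sinh (2 * t)) * deriv u t
      = lam * (lam - 2) * u t)
    {B : ℝ} (hB : ∀ᶠ t in 𝓝[>] (0 : ℝ), |u t| ≤ B) :
    ∃ c : ℝ, ∀ t, 0 < t → u t = c * sph lam (hyp t) := by
  refine exists_eq_const_mul_sph_of_bounded lam (fun t ht => (hu t ht).hasDerivAt)
    (fun t ht => (hu' t ht).hasDerivAt) ?_ hB
  intro t ht
  have hS : Real.sinh (2 * t) ≠ 0 := (sinh_two_mul_pos ht).ne'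
  have h := hode t ht
  have e : Real.sinh (2 * t) * (2 * (Real.cosh (2 * t) / Real.sinh (2 * t)) * deriv u t)
      = 2 * Real.cosh (2 * t) * deriv u t := by
    field_simp
  linear_combination Real.sinh (2 * t) * h - e

/-! ### `λ = 2n + 2`: the second-kind function blows up at the origin -/

/-- **`Q_n(cosh 2t) → +∞` as `t → 0⁺`**: in the basis `φ_{2n+2}(a_·), ψ_{2n+2}` the coefficient of `ψ` is `−2`. -/
theorem tendsto_sphQ_nhdsGT_zero (n : ℕ) : Tendsto (sphQ n) (𝓝[>] 0) atTop := by
  have hψ : Tendsto (fun t => -2 * sphSecond (2 * (n : ℝ) + 2) t) (𝓝[>] 0) atTop :=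
    (tendsto_sphSecond_nhdsGT_zero (2 * (n : ℝ) + 2)).const_mul_atBot_of_neg (by norm_num)
  have hφ : Tendsto (fun t => (sphQ n 1 / sph (2 * (n : ℝ) + 2) (hyp 1)) * sph (2 * (n : ℝ) + 2) (hyp t))
      (𝓝[>] 0) (𝓝 ((sphQ n 1 / sph (2 * (n : ℝ) + 2) (hyp 1)) * 1)) :=
    (tendsto_sph_hyp_nhdsGT_zero _).const_mul _
  refine (hψ.atTop_add hφ).congr' ?_
  filter_upwards [self_mem_nhdsWithin] with t ht
  rw [sphQ_eq n ht]
  ring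

end measure

end Summit.Ventures.HodgeRepro2.T5SU11SphericalRegular
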